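import Literature.Topology.FourManifolds.WeaklyReducibleTrisections
import HarnessLib

/-!
# A separating weak-reducing pair on a genus-three Heegaard surface of `S³` or `S¹ × S²` contains a reducing curve (Aranda–Zupan 2025, Lemma 3.8)

Topic `Literature/Topology/FourManifolds`, after `WeaklyReducibleTrisections.lean` (the vocabulary of
curves, compressing discs and spine handlebodies of a Gay–Kirby trisection) and next to
`DependentTripleGenusThreeTrisections.lean` (the Thm. 1.4 fact it serves).  ONE NAMED FACT, no
definition of a notion, nothing proved:

* `Literature.Topology.FourManifolds.arandaZupan_separatingPair_reducing_gk` — Aranda–Zupan,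
  *Manifolds with weakly reducible genus-three trisections are standard* (arXiv:2503.04607, 2025),
  **Lemma 3.8** (p. 10), verbatim: "Suppose `H₁ ∪_Σ H₂` is a genus-three Heegaard splitting of
  `Y = S³` or `S¹ × S²`, and let `c₁` and `c₂` be a weak-reducing pair of non-separating but
  mutually separating curves.  Then either `c₁` is a reducing curve or `c₂` is a reducing curve."
  Glossary (loc. cit.): a *weak-reducing pair* is a pair of disjoint curves `c₁`, `c₂ ⊂ Σ` bounding
  compressing disks in `H₁` and `H₂` respectively (§2, p. 5); a *reducing curve* is a curve of `Σ`
  that is a compressing curve for both `H₁` and `H₂` (§2, p. 4); `c₁`, `c₂` are *mutually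
  separating* when `c₁ ∪ c₂` separates `Σ` (Remark 2.3, p. 5: "If `c₁` and `c₂` are mutually
  separating, `Σ_{c₁,c₂}` is the disjoint union of two tori").

## How it is rendered (relative to the tree's notions, D-0014)

The tree has no free-standing theory of Heegaard splittings with curves on the Heegaard surface,
but it has exactly this language for the Heegaard splittings that occur as SPINES of Gay–Kirby
trisections (`Trisections.lean`, `WeaklyReducibleTrisections.lean`), which is where Aranda–Zupan
use the lemma (Prop. 3.9, p. 10: "Considering the Heegaard splitting `H_α ∪_Σ H_β` of `Y = S³` or
`S¹ × S²`.  By Lemma 3.8, …"; proof of Thm. 1.4, §7 p. 25: "by applying Lemma 3.8 to the Heegaard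
splitting `H_β ∪ H_γ`").  For an orientable smooth `4`-manifold `M` with a
`(3; k₀, k₁, k₂)`-trisection `T` (`IsGKTrisection M 3 k T`) and three distinct labels `i, j, l`,
the handlebodies `H_i = Trisection.spineHandlebody T i = X_j ∩ X_l` and `H_j = X_i ∩ X_l` of the
spine are genus-`3` handlebodies with common boundary the central surface `F`, and
`H_i ∪_F H_j = ∂X_l ≅ #^{k_l}(S¹ × S²)` (the sector `X_l` is `♮^{k_l}(S¹ × B³)`, clause (ii) of
`IsGKTrisection`); so for `k l ≤ 1` this is a genus-three Heegaard splitting of `S³` (`k_l = 0`)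
or `S¹ × S²` (`k_l = 1`) — the printed setting.  The statement below is Lemma 3.8 for these
splittings: `x`, `y` disjoint curves on `F` (`Trisection.IsCurve`), each non-separating
(`Trisection.IsNonSeparating`), `F ∖ (x ∪ y)` disconnected, `x` compressing in `H_i` and `y` in
`H_j` (`Trisection.BoundsDisc`) ⟹ `x` compresses in `H_j` too, or `y` compresses in `H_i` too.

One point of translation is made explicit.  In print "a curve" is a free homotopy class of
essential simple closed curves (§2, p. 3), so the two members of a pair are never parallel; the
tree's curves are concrete embedded circles, and two disjoint non-separating concrete curves with
disconnected complement are EITHER parallel (they cobound an annulus of `F`: configuration (1)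
of §7, p. 24, "two of the curves are homotopic") OR cut `F` into two twice-punctured tori
(configuration (2) = mutually separating in the printed sense; Euler characteristic count).  In
the parallel case the conclusion is the printed remark disposing of configuration (1) (§7, p. 25:
"In case (1), `𝒯` is weakly reducible", parallel curves bounding parallel discs; cf. §2 p. 3,
"`D` is determined up to isotopy by its boundary").  So the def is Lemma 3.8 together with that
remark — binder for binder the inline hypothesis `hL38` under which
`DependentTripleGenusThreeTrisectionsProofs.lean` (`fiveChainCase_of_separatingPair_of_pantsCase`)
already tracks the Thm. 1.4 fact, there specialised to `k = (1,1,1)` and stated without the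
orientability hypothesis.  Orientability of `M` is assumed here because it is a standing
convention of the source (§2, p. 3: "All manifolds are smooth and orientable").

Printed proof (p. 10): untelescope along the pair to a generalized Heegaard splitting
`(Σ_{c₁}, Σ_{c₁,c₂}, Σ_{c₂})`; the thin level is two tori, compressible in `Y`; by
Casson–Gordon / Scharlemann–Thompson (Prop. 2.4 [CG87, ST94]) and Lemma 3.4 a thick genus-two
surface is reducible; uniqueness of the separating compressing disc of the small compression body
(Lemma 3.6) and handle slides over the scars (Remark 2.1) turn its reducing curve into `c₂`
(resp. `c₁`).  None of this `3`-manifold machinery is in the tree; users take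
`(h : arandaZupan_separatingPair_reducing_gk)`.

## References

* R. Aranda, A. Zupan, *Manifolds with weakly reducible genus-three trisections are standard*,
  arXiv:2503.04607 (2025): Lemma 3.8 (p. 10); §2 (pp. 3–5), Remark 2.3; Prop. 3.9 (p. 10); §7
  (pp. 24–25).  Held: `paper:arxiv-2503.04607`. [ArandaZupan2025]
* A. Casson, C. Gordon, *Reducing Heegaard splittings*, Topology Appl. 27 (1987) 275–283. [CG87]
* M. Scharlemann, A. Thompson, *Thin position for 3-manifolds*, Contemp. Math. 164 (1994). [ST94]
* D. Gay, R. Kirby, *Trisecting 4-manifolds*, Geom. Topol. 20 (2016), Def. 1. [GayKirby2016]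
-/

noncomputable section

open scoped Manifold ContDiff Topology
open Set

namespace Literature.Topology.FourManifolds

universe u

/-- **Aranda–Zupan 2025, Lemma 3.8 (named fact, on the spine of a genus-three Gay–Kirby
trisection): a separating weak-reducing pair of non-separating curves contains a reducing
curve.**  Printed (arXiv:2503.04607, p. 10): "Suppose `H₁ ∪_Σ H₂` is a genus-three Heegaard
splitting of `Y = S³` or `S¹ × S²`, and let `c₁` and `c₂` be a weak-reducing pair of
non-separating but mutually separating curves.  Then either `c₁` is a reducing curve or `c₂` is
a reducing curve."  Here: `M` an orientable smooth `4`-manifold with a `(3; k₀,k₁,k₂)`-trisection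
`T`; `i, j, l` the three labels with `k l ≤ 1`, so that `H_i ∪_F H_j = ∂X_l ≅ #^{k_l}(S¹ × S²)`
is a genus-three Heegaard splitting of `S³` or `S¹ × S²` (`H_p = Trisection.spineHandlebody T p`,
`F` the central surface); `x`, `y` disjoint curves on `F`, each non-separating, `F ∖ (x ∪ y)`
disconnected, `x` bounding a compressing disc of `H_i` and `y` one of `H_j`; conclusion: `x`
also bounds a compressing disc of `H_j`, or `y` also bounds one of `H_i`.  With concrete curves
the hypothesis also admits the parallel pair (configuration (1) of §7, p. 24), whose conclusion
is the remark "In case (1), `𝒯` is weakly reducible" (p. 25; parallel curves bound parallel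
discs) — so this is Lemma 3.8 with that remark folded in, i.e. the inline hypothesis `hL38` of
`DependentTripleGenusThreeTrisectionsProofs.fiveChainCase_of_separatingPair_of_pantsCase` at
general type `k` plus orientability.  Users take `(h : arandaZupan_separatingPair_reducing_gk)`.
-- TODO(general form): every genus-three Heegaard splitting `H₁ ∪_Σ H₂` of `S³` or `S¹ × S²`
-- (`IsHeegaardSplitting` of `LickorishWallace.lean`), not only the spines of trisections.
[cite: ArandaZupan2025, Lemma 3.8 (p. 10); §2 (pp. 3–5) and Remark 2.3; §7 (pp. 24–25)] -/
def arandaZupan_separatingPair_reducing_gk : Prop :=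
  ∀ (M : Type u) [TopologicalSpace M] [T2Space M] [SecondCountableTopology M]
    [ChartedSpace (EuclideanSpace ℝ (Fin 4)) M] [IsManifold (𝓡 4) ∞ M],
    IsOrientable (𝓡 4) M → ∀ (k : Fin 3 → ℕ) (T : Fin 3 → Set M), IsGKTrisection M 3 k T →
    ∀ i j l : Fin 3, i ≠ j → l ≠ i → l ≠ j → k l ≤ 1 →
    ∀ x y : Set M, Trisection.IsCurve T x → Trisection.IsCurve T y → Disjoint x y →
      Trisection.IsNonSeparating T x → Trisection.IsNonSeparating T y →
      ¬ IsPreconnected (Trisection.centralSurfaceSet T \ (x ∪ y)) →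
      Trisection.BoundsDisc T (Trisection.spineHandlebody T i) x →
      Trisection.BoundsDisc T (Trisection.spineHandlebody T j) y →
      Trisection.BoundsDisc T (Trisection.spineHandlebody T j) x ∨
        Trisection.BoundsDisc T (Trisection.spineHandlebody T i) y


end Literature.Topology.FourManifolds

end
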